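import Mathlib
import Summits.NavierStokesRegularity.NavierStokesRegularity.Theorems.FilamentSkeletonRssSkeletonJ1RLiaDefectDerivResidual
import Summits.NavierStokesRegularity.NavierStokesRegularity.Theorems.FilamentSkeletonRssSkeletonJ1RLiaDefectDerivStrands
import Summits.NavierStokesRegularity.NavierStokesRegularity.Theorems.FilamentSkeletonRssSkeletonJ1RLiaDefectDerivCurvature
import Literature.Analysis.Calculus.SmoothCutoff

/-!
# Crux `SkeletonJ1R` (stmt-NavierStokesRegularity-23610) · line `streamline_kantorovich_R` · toward stub F2-d (`LiaDefectDerivBL`, v7):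
# THE DERIVATIVE OF THE STRAND RESIDUAL ALONG THE REFERENCE (explicit), AND THE RESIDUAL FORM OF `D′` AT INTERIOR COLLAR POINTS

Lead `ns-fsr-lead-23610` g2, `--supports stmt-NavierStokesRegularity-23610 --as helper`.  MODEL rung, NEGATIVE side of the ladder: calculus for a
HYPOTHETICAL filament-type blow-up skeleton; nothing here is a claim about Navier–Stokes regularity; the stub and the crux stay OPEN.

* `IsLiaReference.hasDerivAt_residual` — on the closed switched region `‖x_j τ‖² ≤ 2ℓ²` the strand residual
  `R(τ) = c_j A_j − β x_j′ × x_j″ + Σ_{k≠j} c_k (A_k − B_k)` (all strands evaluated at `x_j τ`) is differentiable along the reference with the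
  explicit derivative assembled from `…LiaDefectDerivStrands` (`Ȧ_k`: matched-kernel directional integrals; `Ḃ_k`: Lorentzians in closed form) and
  `…LiaDefectDerivCurvature` (`(x_j″)′` through the ODE);
* `IsLiaReference.swDefect_hasDerivAt_residualForm` — at INTERIOR points `‖x_j τ‖² < 2ℓ²` the defect equals `σ₀ • (R − ⟪R,P⟫P)` on a neighbourhood,
  hence `D′ = σ′ • (R − ⟪R,P⟫P) + σ₀ • (R′ − ⟪R′,P⟫P − ⟪R,P′⟫P − ⟪R,P⟫P′)` (`P = x_j′ τ`, `P′ = x_j″ τ`; `σ′` the explicit switch-weight derivative) —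
  the form the F2-d collar bound estimates term by term;
* `swDefect_hasDerivAt_zero_of_le_sq` — in the closed model region `2ℓ² ≤ ‖x_j τ‖²` (in particular at the collar's outer EDGE) `D′ = 0`: there
  `σ₀ = 0` and `σ′ = 0` (`smoothTransition` is flat at `0`), so the edge case of F2-d is free;
* `norm_switchDeriv_smul_perp_mul_le` — the `σ′`-term costs `ℓ‖σ′•P⊥R‖ ≤ 2√2·Cφ·‖R‖`: it inherits the F2-B envelopes of `‖R‖`.
-/

set_option linter.dupNamespace false -- `NavierStokesRegularity.NavierStokesRegularity` path/namespace repetition is the tree convention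

noncomputable section

namespace Summit.NavierStokesRegularity.NavierStokesRegularity.Theorems.SkeletonJ1RFrame

open Set Function Filter MeasureTheory Real Topology
open Literature.Analysis.FluidPDE
open Summit.NavierStokesRegularity.NavierStokesRegularity.Theorems.MatchedKernel
open Summit.NavierStokesRegularity.NavierStokesRegularity.Theorems.SkeletonJ1RLiaSelf (contDiff_one_deriv)
open scoped InnerProductSpace BigOperators

variable {N : ℕ} {Γ Rb ρ lam c C : ℝ} {p t : Fin N → EuclideanSpace ℝ (Fin 3)} {γ : Fin N → ℝ} {α : ℝ} {s₀ : Fin N → ℝ}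
  {x : Fin N → ℝ → EuclideanSpace ℝ (Fin 3)} {M : EuclideanSpace ℝ (Fin 3) → EuclideanSpace ℝ (Fin 3)}

/-! ## §1 The derivative of the strand residual along the reference -/

/-- **THE STRAND RESIDUAL IS DIFFERENTIABLE ALONG THE REFERENCE ON THE SWITCHED REGION, EXPLICITLY.** [folklore] -/
theorem IsLiaReference.hasDerivAt_residual (hx : IsLiaReference Γ Rb p t γ α s₀ x) (ht : ∀ k, ‖t k‖ = 1) (hc : 0 < c)
    (hxg : ∀ k σ, c * |σ| - C ≤ ‖x k σ‖) (hℓ : Rb * Real.sqrt (Γ * Real.log Γ) ≠ 0) (j : Fin N) (τ : ℝ)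
    (hreg : ‖x j τ‖ ^ 2 ≤ 2 * (Rb * Real.sqrt (Γ * Real.log Γ)) ^ 2) :
    HasDerivAt (fun τ' => ((Γ * γ j / (4 * Real.pi)) • (∫ σ : ℝ, ((‖x j τ' - x j σ‖ ^ 2 +
          Real.exp (-(1+Real.eulerMascheroniConstant-Real.log 2)) * (1:ℝ)) ^ (3 / 2 : ℝ))⁻¹ • cross (deriv (x j) σ) (x j τ' - x j σ)) -
        liaCoeff Γ γ j • cross (deriv (x j) τ') (deriv (deriv (x j)) τ')) +
        ∑ k ∈ Finset.univ.erase j, (Γ * γ k / (4 * Real.pi)) • ((∫ σ : ℝ, ((‖x j τ' - x k σ‖ ^ 2 +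
          Real.exp (-(1+Real.eulerMascheroniConstant-Real.log 2)) * (1:ℝ)) ^ (3 / 2 : ℝ))⁻¹ • cross (deriv (x k) σ) (x j τ' - x k σ)) -
        ∫ σ : ℝ, ((‖x j τ' - datumLine Γ p t s₀ k σ‖ ^ 2 +
          Real.exp (-(1+Real.eulerMascheroniConstant-Real.log 2)) * (1:ℝ)) ^ (3 / 2 : ℝ))⁻¹ • cross (t k) (x j τ' - datumLine Γ p t s₀ k σ)))
      ((Γ * γ j / (4 * Real.pi)) • (∫ σ : ℝ, ((-3 * ⟪x j τ - x j σ, deriv (x j) τ⟫_ℝ *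
            ((‖x j τ - x j σ‖ ^ 2 + Real.exp (-(1 + Real.eulerMascheroniConstant - Real.log 2)) * (1:ℝ)) ^ (5 / 2 : ℝ))⁻¹) •
          cross (deriv (x j) σ) (x j τ - x j σ) +
        ((‖x j τ - x j σ‖ ^ 2 + Real.exp (-(1 + Real.eulerMascheroniConstant - Real.log 2)) * (1:ℝ)) ^ (3 / 2 : ℝ))⁻¹ •
          cross (deriv (x j) σ) (deriv (x j) τ))) -
        liaCoeff Γ γ j • (cross (deriv (x j) τ) ((liaCoeff Γ γ j)⁻¹ • (cross (deriv (deriv (x j)) τ) (ambientField Γ p t γ α s₀ j (x j τ)) +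
            cross (deriv (x j) τ) (fderiv ℝ (ambientField Γ p t γ α s₀ j) (x j τ) (deriv (x j) τ)))) +
          cross (deriv (deriv (x j)) τ) (deriv (deriv (x j)) τ)) +
        ∑ k ∈ Finset.univ.erase j, (Γ * γ k / (4 * Real.pi)) • ((∫ σ : ℝ, ((-3 * ⟪x j τ - x k σ, deriv (x j) τ⟫_ℝ *
            ((‖x j τ - x k σ‖ ^ 2 + Real.exp (-(1 + Real.eulerMascheroniConstant - Real.log 2)) * (1:ℝ)) ^ (5 / 2 : ℝ))⁻¹) •
          cross (deriv (x k) σ) (x j τ - x k σ) +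
        ((‖x j τ - x k σ‖ ^ 2 + Real.exp (-(1 + Real.eulerMascheroniConstant - Real.log 2)) * (1:ℝ)) ^ (3 / 2 : ℝ))⁻¹ •
          cross (deriv (x k) σ) (deriv (x j) τ))) -
        ((-(2 * (2 * ⟪x j τ - waistPt Γ p t s₀ k, deriv (x j) τ⟫_ℝ -
              2 * ⟪x j τ - waistPt Γ p t s₀ k, t k⟫_ℝ * ⟪deriv (x j) τ, t k⟫_ℝ)) /
            (‖x j τ - waistPt Γ p t s₀ k‖ ^ 2 - ⟪x j τ - waistPt Γ p t s₀ k, t k⟫_ℝ ^ 2 +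
              Real.exp (-(1+Real.eulerMascheroniConstant-Real.log 2)) * (1:ℝ)) ^ 2) • cross (t k) (x j τ - waistPt Γ p t s₀ k) +
        (2 / (‖x j τ - waistPt Γ p t s₀ k‖ ^ 2 - ⟪x j τ - waistPt Γ p t s₀ k, t k⟫_ℝ ^ 2 +
            Real.exp (-(1+Real.eulerMascheroniConstant-Real.log 2)) * (1:ℝ))) • cross (t k) (deriv (x j) τ)))) τ := by
  have hC2 : ∀ k, ContDiff ℝ 2 (x k) := fun k => (hx k).1
  have hC1 : ∀ k, ContDiff ℝ 1 (x k) := fun k => (hC2 k).of_le (by norm_num)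
  have hx1 : ∀ k σ, ‖deriv (x k) σ‖ ≤ 1 := fun k σ => ((hx k).2.1 σ).le
  have hp : HasDerivAt (x j) (deriv (x j) τ) τ := (((hC2 j).differentiable (by norm_num)) τ).hasDerivAt
  have hT : HasDerivAt (fun τ' => deriv (x j) τ') (deriv (deriv (x j)) τ) τ :=
    (((contDiff_one_deriv (hC2 j)).differentiable one_ne_zero) τ).hasDerivAt
  -- strands
  have hA : ∀ k, HasDerivAt (fun τ' => ∫ σ : ℝ, ((‖x j τ' - x k σ‖ ^ 2 +
          Real.exp (-(1+Real.eulerMascheroniConstant-Real.log 2)) * (1:ℝ)) ^ (3 / 2 : ℝ))⁻¹ • cross (deriv (x k) σ) (x j τ' - x k σ))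
      (∫ σ : ℝ, ((-3 * ⟪x j τ - x k σ, deriv (x j) τ⟫_ℝ *
            ((‖x j τ - x k σ‖ ^ 2 + Real.exp (-(1 + Real.eulerMascheroniConstant - Real.log 2)) * (1:ℝ)) ^ (5 / 2 : ℝ))⁻¹) •
          cross (deriv (x k) σ) (x j τ - x k σ) +
        ((‖x j τ - x k σ‖ ^ 2 + Real.exp (-(1 + Real.eulerMascheroniConstant - Real.log 2)) * (1:ℝ)) ^ (3 / 2 : ℝ))⁻¹ •
          cross (deriv (x k) σ) (deriv (x j) τ))) τ := fun k =>
    hasDerivAt_strand_comp hc (hC1 k) (hx1 k) (hxg k) hp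
  have hB : ∀ k, HasDerivAt (fun τ' => ∫ σ : ℝ, ((‖x j τ' - datumLine Γ p t s₀ k σ‖ ^ 2 +
          Real.exp (-(1+Real.eulerMascheroniConstant-Real.log 2)) * (1:ℝ)) ^ (3 / 2 : ℝ))⁻¹ • cross (t k) (x j τ' - datumLine Γ p t s₀ k σ))
      ((-(2 * (2 * ⟪x j τ - waistPt Γ p t s₀ k, deriv (x j) τ⟫_ℝ -
              2 * ⟪x j τ - waistPt Γ p t s₀ k, t k⟫_ℝ * ⟪deriv (x j) τ, t k⟫_ℝ)) /
            (‖x j τ - waistPt Γ p t s₀ k‖ ^ 2 - ⟪x j τ - waistPt Γ p t s₀ k, t k⟫_ℝ ^ 2 +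
              Real.exp (-(1+Real.eulerMascheroniConstant-Real.log 2)) * (1:ℝ)) ^ 2) • cross (t k) (x j τ - waistPt Γ p t s₀ k) +
        (2 / (‖x j τ - waistPt Γ p t s₀ k‖ ^ 2 - ⟪x j τ - waistPt Γ p t s₀ k, t k⟫_ℝ ^ 2 +
            Real.exp (-(1+Real.eulerMascheroniConstant-Real.log 2)) * (1:ℝ))) • cross (t k) (deriv (x j) τ)) τ := fun k =>
    hasDerivAt_datumStrand_comp Γ p t s₀ ht k hp
  -- the LIA term
  have hT' := hx.hasDerivAt_deriv_deriv ht hℓ j τ hreg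
  have hLIA : HasDerivAt (fun τ' => cross (deriv (x j) τ') (deriv (deriv (x j)) τ'))
      (cross (deriv (x j) τ) ((liaCoeff Γ γ j)⁻¹ • (cross (deriv (deriv (x j)) τ) (ambientField Γ p t γ α s₀ j (x j τ)) +
            cross (deriv (x j) τ) (fderiv ℝ (ambientField Γ p t γ α s₀ j) (x j τ) (deriv (x j) τ)))) +
          cross (deriv (deriv (x j)) τ) (deriv (deriv (x j)) τ)) τ := by
    have h := crossCLM.hasDerivAt_of_bilinear (fun _ => hT) (fun _ => hT')
    simpa only [crossCLM_apply] using h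
  -- assembly
  have hself := ((hA j).const_smul (Γ * γ j / (4 * Real.pi))).sub (hLIA.const_smul (liaCoeff Γ γ j))
  have hsum := HasDerivAt.fun_sum (u := Finset.univ.erase j) fun k _ => ((hA k).sub (hB k)).const_smul (Γ * γ k / (4 * Real.pi))
  exact hself.add hsum

/-! ## §2 The residual form of `D′` at interior collar points -/

/-- **THE RESIDUAL FORM OF THE DERIVATIVE OF THE DEFECT AT INTERIOR POINTS OF THE SWITCHED REGION** (`‖x_j τ‖² < 2ℓ²`; sliced model at `λ`,
`0 ≤ ρ√Γ`, `β ≠ 0`): with `R` the strand residual (hypothesis `hRdef`) and ANY derivative `R′` of it at `τ` (e.g. the one of `hasDerivAt_residual`), `P = x_j′ τ`, `P′ = x_j″ τ`, `σ₀ = switchWeight ℓ 1 (x_j τ)` and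
`σ′ = smoothTransition′(1 − (‖x_j τ‖²/ℓ² + 1 − 2))·(−2⟪x_j τ, P⟫/ℓ²)`:
`D′ = σ′•(R − ⟪R,P⟫P) + σ₀•(R′ − ⟪R′,P⟫P − ⟪R,P′⟫P − ⟪R,P⟫P′)`. [folklore] -/
theorem IsLiaReference.swDefect_hasDerivAt_residualForm (hx : IsLiaReference Γ Rb p t γ α s₀ x) (hM : SlicedModel Γ ρ lam t x M)
    (hρΓ : 0 ≤ ρ * Real.sqrt Γ) (hℓ : Rb * Real.sqrt (Γ * Real.log Γ) ≠ 0) (j : Fin N) (hβ : liaCoeff Γ γ j ≠ 0) (τ : ℝ)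
    (hint : ‖x j τ‖ ^ 2 < 2 * (Rb * Real.sqrt (Γ * Real.log Γ)) ^ 2)
    {R : ℝ → EuclideanSpace ℝ (Fin 3)} {R' : EuclideanSpace ℝ (Fin 3)}
    (hRdef : ∀ τ', R τ' = ((Γ * γ j / (4 * Real.pi)) • (∫ σ : ℝ, ((‖x j τ' - x j σ‖ ^ 2 +
          Real.exp (-(1+Real.eulerMascheroniConstant-Real.log 2)) * (1:ℝ)) ^ (3 / 2 : ℝ))⁻¹ • cross (deriv (x j) σ) (x j τ' - x j σ)) -
        liaCoeff Γ γ j • cross (deriv (x j) τ') (deriv (deriv (x j)) τ')) +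
        ∑ k ∈ Finset.univ.erase j, (Γ * γ k / (4 * Real.pi)) • ((∫ σ : ℝ, ((‖x j τ' - x k σ‖ ^ 2 +
          Real.exp (-(1+Real.eulerMascheroniConstant-Real.log 2)) * (1:ℝ)) ^ (3 / 2 : ℝ))⁻¹ • cross (deriv (x k) σ) (x j τ' - x k σ)) -
        ∫ σ : ℝ, ((‖x j τ' - datumLine Γ p t s₀ k σ‖ ^ 2 +
          Real.exp (-(1+Real.eulerMascheroniConstant-Real.log 2)) * (1:ℝ)) ^ (3 / 2 : ℝ))⁻¹ • cross (t k) (x j τ' - datumLine Γ p t s₀ k σ)))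
    (hR : HasDerivAt R R' τ) :
    HasDerivAt (fun τ' : ℝ => swDefect Γ Rb γ α M x j τ')
      ((deriv Real.smoothTransition (1 - (‖x j τ‖ ^ 2 / (Rb * Real.sqrt (Γ * Real.log Γ)) ^ 2 + 1 - 2 * (1:ℝ))) *
            (-(2 * ⟪x j τ, deriv (x j) τ⟫_ℝ / (Rb * Real.sqrt (Γ * Real.log Γ)) ^ 2))) • (R τ - ⟪R τ, deriv (x j) τ⟫_ℝ • deriv (x j) τ) +
        switchWeight (Rb * Real.sqrt (Γ * Real.log Γ)) 1 (x j τ) •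
          (R' - ⟪R', deriv (x j) τ⟫_ℝ • deriv (x j) τ - ⟪R τ, deriv (deriv (x j)) τ⟫_ℝ • deriv (x j) τ
            - ⟪R τ, deriv (x j) τ⟫_ℝ • deriv (deriv (x j)) τ)) τ := by
  have hC2 : ContDiff ℝ 2 (x j) := (hx j).1
  have hunit : ∀ s, ‖deriv (x j) s‖ = 1 := (hx j).2.1
  have hp : HasDerivAt (x j) (deriv (x j) τ) τ := ((hC2.differentiable (by norm_num)) τ).hasDerivAt
  have hT : HasDerivAt (fun τ' => deriv (x j) τ') (deriv (deriv (x j)) τ) τ :=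
    (((contDiff_one_deriv hC2).differentiable one_ne_zero) τ).hasDerivAt
  have hP1 : ‖deriv (x j) τ‖ = 1 := hunit τ
  have hPP' : ⟪deriv (x j) τ, deriv (deriv (x j)) τ⟫_ℝ = 0 := by
    rw [real_inner_comm]; exact inner_deriv_deriv_deriv_eq_zero hC2 hunit τ
  -- the identity holds on a neighbourhood of τ (interior point: open condition)
  have hopen : ∀ᶠ τ' in 𝓝 τ, ‖x j τ'‖ ^ 2 < 2 * (Rb * Real.sqrt (Γ * Real.log Γ)) ^ 2 := by
    have hcont : Continuous (fun τ' => ‖x j τ'‖ ^ 2) := (hC2.continuous.norm).pow 2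
    exact hcont.continuousAt.eventually_lt continuousAt_const hint
  have hev : (fun τ' : ℝ => swDefect Γ Rb γ α M x j τ') =ᶠ[𝓝 τ]
      fun τ' => switchWeight (Rb * Real.sqrt (Γ * Real.log Γ)) 1 (x j τ') • (R τ' - ⟪R τ', deriv (x j) τ'⟫_ℝ • deriv (x j) τ') := by
    filter_upwards [hopen] with τ' hτ'
    rw [hRdef τ']
    exact hx.swDefect_eq_smul_perp_residual hM hρΓ hℓ j hβ τ' hτ'.le
  -- differentiate the right-hand side
  have hσ := hasDerivAt_switchWeight_comp (ℓ := Rb * Real.sqrt (Γ * Real.log Γ)) (s := (1:ℝ)) hp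
  have hperp := hasDerivAt_perp_unitSpeed hR hT hP1 hPP'
  have hperp' : HasDerivAt (fun τ' => R τ' - ⟪R τ', deriv (x j) τ'⟫_ℝ • deriv (x j) τ')
      (R' - ⟪R', deriv (x j) τ⟫_ℝ • deriv (x j) τ - ⟪R τ, deriv (deriv (x j)) τ⟫_ℝ • deriv (x j) τ
        - ⟪R τ, deriv (x j) τ⟫_ℝ • deriv (deriv (x j)) τ) τ := by
    refine hperp.congr_of_eventuallyEq (Eventually.of_forall fun τ' => ?_)
    simp only [hunit τ', one_pow, div_one]
  have h := hσ.smul hperp'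
  refine (h.congr_of_eventuallyEq hev).congr_deriv ?_
  rw [add_comm]

/-! ## §3 The closed model region, in particular the outer edge of the collar: `D′ = 0` -/

/-- **In the closed model region `2ℓ² ≤ ‖x_j τ‖²` the defect has derivative `0` along the reference** (unit-speed `C²` proper filaments with sliced
model, `ℓ ≠ 0`): the switch weight and its derivative along the reference both vanish there. In particular F2-d is free at the collar's outer
edge `‖x_j τ‖² = 2ℓ²`. [folklore] -/
theorem swDefect_hasDerivAt_zero_of_le_sq {Rb : ℝ} (hM : SlicedModel Γ ρ lam t x M) (hρΓ : 0 ≤ ρ * Real.sqrt Γ) (hc : 0 < c)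
    (hx : ∀ k, ContDiff ℝ 2 (x k)) (hunit : ∀ k σ, ‖deriv (x k) σ‖ = 1) (hxg : ∀ k σ, c * |σ| - C ≤ ‖x k σ‖)
    (hℓ : Rb * Real.sqrt (Γ * Real.log Γ) ≠ 0) (j : Fin N) (τ : ℝ) (hout : 2 * (Rb * Real.sqrt (Γ * Real.log Γ)) ^ 2 ≤ ‖x j τ‖ ^ 2) :
    HasDerivAt (fun τ' : ℝ => swDefect Γ Rb γ α M x j τ') 0 τ := by
  have h := swDefect_hasDerivAt_ref (Γ := Γ) (γ := γ) (α := α) (Rb := Rb) hM hρΓ hc hx hunit hxg j τ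
  have hσ0 : switchWeight (Rb * Real.sqrt (Γ * Real.log Γ)) 1 (x j τ) = 0 :=
    switchWeight_eq_zero_of_le_sq hℓ (by linarith)
  have harg : 1 - (‖x j τ‖ ^ 2 / (Rb * Real.sqrt (Γ * Real.log Γ)) ^ 2 + 1 - 2 * (1:ℝ)) ≤ 0 := by
    have hℓ2 : 0 < (Rb * Real.sqrt (Γ * Real.log Γ)) ^ 2 := by positivity
    have : 2 ≤ ‖x j τ‖ ^ 2 / (Rb * Real.sqrt (Γ * Real.log Γ)) ^ 2 := by rw [le_div_iff₀ hℓ2]; linarith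
    linarith
  rw [Literature.Analysis.Calculus.deriv_smoothTransition_of_nonpos harg, zero_mul, zero_smul, hσ0, zero_smul, add_zero] at h
  exact h

/-! ## §4 The switch-derivative term of `D′` on the collar costs nothing beyond the F2-B residual bound -/

/-- **The `σ′`-term of the residual form on the collar**: `ℓ·‖σ′ • (R − ⟪R,P⟫P)‖ ≤ 2√2·Cφ·‖R‖` whenever `‖x_j τ‖² ≤ 2ℓ²`, `ℓ > 0`, `‖P‖ = 1`
(`Cφ` any bound of `|smoothTransition′|`, e.g. `…LiaDefectDerivRef.abs_deriv_smoothTransition_le`). So this term inherits the F2-B envelopes of `‖R‖`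
(`…LiaDefectSelfBound.selfTerm_bound`, `…LiaDefectPartnerBound.partnerTerm_bound`). [folklore] -/
theorem norm_switchDeriv_smul_perp_mul_le {Cφ ℓ a : ℝ} (hCφ : ∀ r : ℝ, |deriv Real.smoothTransition r| ≤ Cφ) (hC0 : 0 ≤ Cφ) (hℓ : 0 < ℓ)
    {y P R : EuclideanSpace ℝ (Fin 3)} (hy : ‖y‖ ^ 2 ≤ 2 * ℓ ^ 2) (hP : ‖P‖ = 1) :
    ℓ * ‖(deriv Real.smoothTransition a * (-(2 * ⟪y, P⟫_ℝ / ℓ ^ 2))) • (R - ⟪R, P⟫_ℝ • P)‖ ≤ 2 * Real.sqrt 2 * Cφ * ‖R‖ := by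
  have h1 := abs_switchWeight_deriv_mul_le hCφ hC0 hℓ hy hP.le a
  have h2 : ‖R - ⟪R, P⟫_ℝ • P‖ ≤ ‖R‖ := norm_perpTo_le P R hP
  rw [norm_smul, Real.norm_eq_abs]
  calc ℓ * (|deriv Real.smoothTransition a * (-(2 * ⟪y, P⟫_ℝ / ℓ ^ 2))| * ‖R - ⟪R, P⟫_ℝ • P‖)
      = (|deriv Real.smoothTransition a * (-(2 * ⟪y, P⟫_ℝ / ℓ ^ 2))| * ℓ) * ‖R - ⟪R, P⟫_ℝ • P‖ := by ring
    _ ≤ (2 * Real.sqrt 2 * Cφ) * ‖R‖ := mul_le_mul h1 h2 (norm_nonneg _) (by positivity)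
    _ = 2 * Real.sqrt 2 * Cφ * ‖R‖ := by ring

end Summit.NavierStokesRegularity.NavierStokesRegularity.Theorems.SkeletonJ1RFrame

end
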